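import Mathlib
import Summits.ValiantsHypothesis.ValiantsHypothesis.Theorems.BarrierLeverPartitionMinorsHitByVPHiddenStatesFullJoinLeaf

/-!
# Route BarrierLever — item `PartitionMinorsHitByVP` (stmt-ValiantsHypothesis-19717), line `hidden_states`:
# THE EXCHANGE PRINCIPLE — any independence argument for a CORE extends to «core + free states» (explicit completion, no genericity)

Helper file (`--supports stmt-ValiantsHypothesis-19717`; cell valiant-natproofs, rung V4, 𝒟-side door (c), line
`Cruxes/PartitionMinorsHitByVP/Lines/hidden_states.lean` v9; prover seat val-np-p3 gen 17). Definition-free; closes NO item.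
The general form of the completion step of `…FullJoinTrace` (p684990, where the core table was the explicit trace table).

* `exists_table_of_indep_core` — let the one-cube design `J : Fin r → Finset (Fin K)` consist of CORE members (inside a state set `core`)
  and FREE members (singletons `{q}`, `q ∉ core`). If SOME table `tx₀` makes the core columns
  `(∏_{a ∈ u i}(tx₀ none a + Σ_{q ∈ J k} tx₀ (some q) a))_i` linearly independent in `ℂ^r`, then a table that agrees with `tx₀` on the base row
  and on the core states and sends the free state of `{q}` to `𝟙_W − tx₀ none` (for a suitable row set `W = u i_k`, so that the free column reads
  `[u i ⊆ W]`) makes the whole design matrix nonsingular. PROOF: the inclusion columns `[u i ⊆ u k]` form a basis of `ℂ^r`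
  (`inclusionMatrix_isUnit`, p675793); Steinitz exchange (`LinearIndepOn.id_insert`, `finrank_span_finset_eq_card`) completes the independent
  core columns by `r − #core` of them; the resulting column family is an injective enumeration of an independent set, hence the matrix is a unit.
  USE: tropical / Gram / any future certificate for the CORE of a design with a free reservoir (the hybrid universal design of the line keeps up
  to `h³` free states) needs to establish independence only, never spanning.

WHAT THIS IS NOT: no family is certified here; item 19717 OPEN; nothing on crux 14610 or VP ≠ VNP.
-/

set_option linter.dupNamespace false

namespace Summit.ValiantsHypothesis.ValiantsHypothesis.Theorems.BarrierLever.HiddenStates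

open Finset Matrix

noncomputable section

namespace FullJoin

variable {h r K : ℕ}

/-- **THE EXCHANGE PRINCIPLE (general core table).** Let the one-cube design consist of CORE members (inside `core`) and FREE members
(singletons `{q}`, `q ∉ core`). If SOME table `tx₀` makes the core columns `(∏_{a ∈ u i}(tx₀ none a + Σ_{q ∈ J k} tx₀ (some q) a))_i`
(`J k ⊆ core`) linearly independent in `ℂ^r`, then some table (equal to `tx₀` on the base row and the core states) makes the whole
design matrix nonsingular: the free states are sent to `𝟙_W − tx₀ none` for suitable row sets `W = u i_k`, whose columns `[u i ⊆ W]`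
complete the core columns by Steinitz exchange against the inclusion basis (`inclusionMatrix_isUnit`). Any future independence argument
for a core (Gram identities as in `exists_table_of_core_trace`, tropical certificates, …) therefore extends to «core + free states». -/
theorem exists_table_of_indep_core (u : Fin r → Finset (Fin h)) (hu : Function.Injective u)
    (J : Fin r → Finset (Fin K)) (hJ : Function.Injective J) (core : Finset (Fin K))
    (hfree : ∀ k, ¬ J k ⊆ core → ∃ q, q ∉ core ∧ J k = {q})
    (tx₀ : Option (Fin K) → Fin h → ℂ)
    (hind : LinearIndependent ℂ fun c : {k : Fin r // J k ⊆ core} =>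
      fun i : Fin r => ∏ a ∈ u i, (tx₀ none a + ∑ q ∈ J c.1, tx₀ (some q) a)) :
    ∃ tx : Option (Fin K) → Fin h → ℂ, (∀ a, tx none a = tx₀ none a) ∧ (∀ q ∈ core, ∀ a, tx (some q) a = tx₀ (some q) a) ∧
      (Matrix.of fun i k : Fin r => ∏ a ∈ u i, (tx none a + ∑ q ∈ J k, tx (some q) a)).det ≠ 0 := by
  classical
  -- inclusion columns `z W = ([u i ⊆ W])_i`
  set z : Finset (Fin h) → (Fin r → ℂ) := fun W i => if u i ⊆ W then 1 else 0 with hz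
  have hzind : LinearIndependent ℂ (fun k : Fin r => z (u k)) := by
    have hP := Matrix.linearIndependent_cols_iff_isUnit.mpr (inclusionMatrix_isUnit u hu)
    have heq : (fun k : Fin r => z (u k)) =
        (Matrix.of fun i k : Fin r => if u i ⊆ u k then (1 : ℂ) else 0).col := by
      funext k i
      simp [hz, Matrix.col]
    rw [heq]
    exact hP
  have hzspan : Submodule.span ℂ (Set.range fun k : Fin r => z (u k)) = ⊤ := by
    apply Submodule.eq_top_of_finrank_eq
    rw [finrank_span_eq_card hzind, Module.finrank_fintype_fun_eq_card]
  set κ : {k : Fin r // J k ⊆ core} → (Fin r → ℂ) :=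
    fun c i => ∏ a ∈ u i, (tx₀ none a + ∑ q ∈ J c.1, tx₀ (some q) a) with hκ
  have hκind : LinearIndependent ℂ κ := hind
  -- Steinitz exchange
  set S₀ : Finset (Fin r → ℂ) := Finset.univ.image κ with hS₀
  have hS₀card : #S₀ = Fintype.card {k : Fin r // J k ⊆ core} := by
    rw [hS₀, Finset.card_image_of_injective _ hκind.injective, Finset.card_univ]
  have hS₀ind : LinearIndepOn ℂ id (S₀ : Set (Fin r → ℂ)) := by
    have := hκind.linearIndepOn_id
    simpa [hS₀] using this
  have hext : ∀ n, n + Fintype.card {k : Fin r // J k ⊆ core} ≤ r → ∃ S₁ : Finset (Fin r → ℂ),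
      S₁ ⊆ Finset.univ.image (fun k => z (u k)) ∧ #S₁ = n ∧ Disjoint S₀ S₁ ∧
      LinearIndepOn ℂ id ((S₀ ∪ S₁ : Finset (Fin r → ℂ)) : Set (Fin r → ℂ)) := by
    intro n
    induction n with
    | zero =>
      intro _
      exact ⟨∅, by simp, by simp, by simp, by simpa using hS₀ind⟩
    | succ n ih =>
      intro hn
      obtain ⟨S₁, hsub, hcard, hdisj, hind'⟩ := ih (by omega)
      have hlt : #(S₀ ∪ S₁) < r := by
        rw [Finset.card_union_of_disjoint hdisj, hS₀card, hcard]; omega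
      have hspan : Submodule.span ℂ ((S₀ ∪ S₁ : Finset (Fin r → ℂ)) : Set (Fin r → ℂ)) ≠ ⊤ := by
        intro htop
        have h1 := finrank_span_finset_eq_card hind'
        rw [htop, finrank_top, Module.finrank_fintype_fun_eq_card, Fintype.card_fin] at h1
        omega
      have hex : ∃ i : Fin r, z (u i) ∉ Submodule.span ℂ ((S₀ ∪ S₁ : Finset (Fin r → ℂ)) : Set (Fin r → ℂ)) := by
        by_contra hall
        push Not at hall
        apply hspan
        rw [eq_top_iff, ← hzspan, Submodule.span_le]
        rintro _ ⟨i, rfl⟩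
        exact hall i
      obtain ⟨i, hi⟩ := hex
      have hnotin : z (u i) ∉ S₀ ∪ S₁ := fun hmem =>
        hi (Submodule.subset_span (Finset.mem_coe.mpr hmem))
      refine ⟨insert (z (u i)) S₁, ?_, ?_, ?_, ?_⟩
      · exact Finset.insert_subset (Finset.mem_image.mpr ⟨i, Finset.mem_univ _, rfl⟩) hsub
      · rw [Finset.card_insert_of_notMem (fun hm => hnotin (Finset.mem_union_right _ hm)), hcard]
      · rw [Finset.disjoint_insert_right]
        exact ⟨fun hm => hnotin (Finset.mem_union_left _ hm), hdisj⟩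
      · have hset : ((S₀ ∪ insert (z (u i)) S₁ : Finset (Fin r → ℂ)) : Set (Fin r → ℂ)) =
            insert (z (u i)) ((S₀ ∪ S₁ : Finset (Fin r → ℂ)) : Set (Fin r → ℂ)) := by
          push_cast
          rw [Set.union_insert]
        rw [hset]
        exact hind'.id_insert hi
  have hcardC : Fintype.card {k : Fin r // J k ⊆ core} ≤ r := by
    simpa using Fintype.card_subtype_le (fun k : Fin r => J k ⊆ core)
  obtain ⟨S₁, hsub, hcard, hdisj, hind'⟩ := hext (r - Fintype.card {k : Fin r // J k ⊆ core}) (by omega)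
  have hcardF : Fintype.card {k : Fin r // ¬ J k ⊆ core} = Fintype.card {x // x ∈ S₁} := by
    rw [Fintype.card_subtype_compl, Fintype.card_fin, Fintype.card_coe, hcard]
  set e₁ : {k : Fin r // ¬ J k ⊆ core} ≃ {x // x ∈ S₁} := Fintype.equivOfCardEq hcardF with he₁
  have hmemS : ∀ f : {k : Fin r // ¬ J k ⊆ core}, ∃ i : Fin r, z (u i) = (e₁ f).1 := by
    intro f
    have := hsub (e₁ f).2
    simpa only [Finset.mem_image, Finset.mem_univ, true_and] using this
  choose row hrow using hmemS
  have hfq : ∀ f : {k : Fin r // ¬ J k ⊆ core}, ∃ q, q ∉ core ∧ J f.1 = {q} := fun f => hfree f.1 f.2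
  choose fq hfq_notin hfq_eq using hfq
  have hfq_inj : Function.Injective fq := by
    intro f f' hff'
    apply Subtype.ext
    apply hJ
    rw [hfq_eq f, hfq_eq f', hff']
  -- THE TABLE: `tx₀` on the base row and on the core, indicator points (minus base) on the free states
  let tx : Option (Fin K) → Fin h → ℂ := fun o a => o.elim (tx₀ none a) (fun q =>
    if q ∈ core then tx₀ (some q) a
    else (if hq : ∃ f : {k : Fin r // ¬ J k ⊆ core}, fq f = q then
      (if a ∈ u (row hq.choose) then 1 else 0) - tx₀ none a else 0))
  refine ⟨tx, fun a => rfl, fun q hq a => by simp only [tx, Option.elim, if_pos hq], ?_⟩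
  set col : Fin r → (Fin r → ℂ) := fun k => if hk : J k ⊆ core then κ ⟨k, hk⟩ else (e₁ ⟨k, hk⟩).1 with hcol
  have hentry_core : ∀ i k, ∀ hk : J k ⊆ core,
      ∏ a ∈ u i, (tx none a + ∑ q ∈ J k, tx (some q) a) = κ ⟨k, hk⟩ i := by
    intro i k hk
    simp only [hκ]
    refine Finset.prod_congr rfl fun a _ => ?_
    have : ∀ q ∈ J k, tx (some q) a = tx₀ (some q) a := by
      intro q hq
      simp only [tx, Option.elim, if_pos (hk hq)]
    rw [Finset.sum_congr rfl this]
    rfl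
  have hentry_free : ∀ i k, ∀ hk : ¬ J k ⊆ core,
      ∏ a ∈ u i, (tx none a + ∑ q ∈ J k, tx (some q) a) = (e₁ ⟨k, hk⟩).1 i := by
    intro i k hk
    rw [← hrow ⟨k, hk⟩]
    have hJk := hfq_eq ⟨k, hk⟩
    have hex : ∃ f : {k : Fin r // ¬ J k ⊆ core}, fq f = fq ⟨k, hk⟩ := ⟨⟨k, hk⟩, rfl⟩
    have hchoose : hex.choose = ⟨k, hk⟩ := hfq_inj hex.choose_spec
    have : ∀ a, tx none a + ∑ q ∈ J k, tx (some q) a = if a ∈ u (row ⟨k, hk⟩) then 1 else 0 := by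
      intro a
      rw [hJk, Finset.sum_singleton]
      simp only [tx, Option.elim, if_neg (hfq_notin ⟨k, hk⟩), dif_pos hex, hchoose]
      ring
    simp_rw [this]
    rw [Finset.prod_boole]
    simp only [hz]
    congr 1
  have hM : (Matrix.of fun i k : Fin r => ∏ a ∈ u i, (tx none a + ∑ q ∈ J k, tx (some q) a)) =
      Matrix.of fun i k : Fin r => col k i := by
    ext i k
    simp only [Matrix.of_apply, hcol]
    by_cases hk : J k ⊆ core
    · rw [dif_pos hk, hentry_core i k hk]
    · rw [dif_neg hk, hentry_free i k hk]
  have hmem_col : ∀ k, col k ∈ ((S₀ ∪ S₁ : Finset (Fin r → ℂ)) : Set (Fin r → ℂ)) := by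
    intro k
    simp only [hcol, Finset.coe_union, Set.mem_union, Finset.mem_coe]
    by_cases hk : J k ⊆ core
    · left; rw [dif_pos hk, hS₀]; exact Finset.mem_image.mpr ⟨⟨k, hk⟩, Finset.mem_univ _, rfl⟩
    · right; rw [dif_neg hk]; exact (e₁ ⟨k, hk⟩).2
  have hcol_inj : Function.Injective col := by
    intro k k' hkk'
    simp only [hcol] at hkk'
    by_cases hk : J k ⊆ core <;> by_cases hk' : J k' ⊆ core
    · rw [dif_pos hk, dif_pos hk'] at hkk'
      exact congrArg Subtype.val (hκind.injective hkk')
    · rw [dif_pos hk, dif_neg hk'] at hkk'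
      exfalso
      have h0 : κ ⟨k, hk⟩ ∈ S₀ := by rw [hS₀]; exact Finset.mem_image.mpr ⟨⟨k, hk⟩, Finset.mem_univ _, rfl⟩
      exact Finset.disjoint_left.mp hdisj h0 (hkk' ▸ (e₁ ⟨k', hk'⟩).2)
    · rw [dif_neg hk, dif_pos hk'] at hkk'
      exfalso
      have h0 : κ ⟨k', hk'⟩ ∈ S₀ := by rw [hS₀]; exact Finset.mem_image.mpr ⟨⟨k', hk'⟩, Finset.mem_univ _, rfl⟩
      exact Finset.disjoint_left.mp hdisj h0 (hkk' ▸ (e₁ ⟨k, hk⟩).2)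
    · rw [dif_neg hk, dif_neg hk'] at hkk'
      exact congrArg Subtype.val (e₁.injective (Subtype.ext hkk'))
  have hcolind : LinearIndependent ℂ col := by
    let g : Fin r → ((S₀ ∪ S₁ : Finset (Fin r → ℂ)) : Set (Fin r → ℂ)) := fun k => ⟨col k, hmem_col k⟩
    have hg : Function.Injective g := fun k k' hkk' => hcol_inj (congrArg Subtype.val hkk')
    have := hind'.comp g hg
    exact this
  rw [hM]
  have hunit : IsUnit (Matrix.of fun i k : Fin r => col k i) := by
    rw [← Matrix.linearIndependent_cols_iff_isUnit]
    exact hcolind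
  obtain ⟨v, hv⟩ := hunit
  rw [← hv]
  exact (Matrix.isUnit_iff_isUnit_det _ |>.mp v.isUnit).ne_zero

end FullJoin

end

end Summit.ValiantsHypothesis.ValiantsHypothesis.Theorems.BarrierLever.HiddenStates
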